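import Mathlib.RingTheory.Ideal.Operations
import Mathlib.RingTheory.Ideal.Span
import Mathlib.Algebra.BigOperators.Group.Finset.Basic
import Mathlib.Tactic.Ring
import HarnessLib

/-!
# Strict transforms of `𝔪`-adic approximations and the radical assembly ([CoP1] Prop. 9.3, (48)–(52))

Topic: `Literature/AlgebraicGeometry/Resolution`. PROOF side of `CossartPiltant2019ReductionP`
(`ArithmeticalThreefoldsLocal.lean`), input (C4), decomposition layer of [CoP1] Prop. 9.3
(hypothesis `hDec` of `cossartPiltant2019ReductionP_of_cjs_of_stableInertiaHensel`). The
elementary ring-theoretic skeleton of the passage (HAL p. 28)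

> `gⱼ =: g′ⱼ ∏ᵢ xᵢ^{cᵢⱼ}` (48), with `g′ⱼ ∈ S′` not divisible by `xᵢ` … Let `C := maxᵢⱼ{cᵢⱼ}`
> (50) and let `hⱼ ∈ R₁` be such that `hⱼ ≡ gⱼ mod m_{R₁′}^{C+1}` … By (48), (50) and property
> (2) above, there is an expression `hⱼ =: h′ⱼ ∏ᵢ xᵢ^{cᵢⱼ}` with `h′ⱼ ∈ S′` … and a congruence
> `h′ⱼ ≡ g′ⱼ mod (x₁⋯x_r) S′`. … `Hⱼ ≡ γ′ⱼ (g′ⱼ)^{det A} mod (x₁⋯x_r) S′` (51) … By (46), (47)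
> and (51), we have `√(({Fᵢ}, {Hⱼ}) S′) = m_{S′}` (52).

("property (2)" is `m_{R₁′} S′ ⊆ √(m_{R₁′} S′) = (x₁⋯x_r)`, so `m_{R₁′}^{C+1} S′ ⊆ (x₁⋯x_r)^{C+1} S′`):

* `prod_pow_succ_mem_span` — PROVED: `(∏ xᵢ)^{C+1} ∈ ((∏ xᵢ^{cᵢ}) · ∏ xᵢ) S` when `cᵢ ≤ C`;
* `exists_strictTransform_of_sub_mem` — PROVED, **(48)+(50) ⟹ the congruence**: if
  `g = g′ ∏ xᵢ^{cᵢ}` and `h ≡ g mod (x₁⋯x_r)^{C+1}` with `cᵢ ≤ C`, then `h = h′ ∏ xᵢ^{cᵢ}` with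
  `h′ ≡ g′ mod (x₁⋯x_r)`;
* `span_le_radical_of_isUnit_mul_pow_mem` — PROVED, **(46)+(47)+(51) ⟹ (52)**: if `I` contains a
  unit times `xᵢ^D` for each `i` and, for each `j`, a unit times `h′ⱼ^D` with
  `h′ⱼ ≡ g′ⱼ mod (x₁, …, x_r)`, then `(x₁, …, x_r, g′_{r+1}, …) ⊆ √I`.

The companion identities `Fᵢ = (∏ γⱼ^{bᵢⱼ}) xᵢ^{det A}` (46) and
`hⱼ^{det A} / ∏ᵢ Fᵢ^{cᵢⱼ} = unit · (h′ⱼ)^{det A}` (49)/(51) are `MonomialAdjugate.lean`.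

Everything is PROVED; no named facts, definitions, instances or notation are introduced.

## Sources

* V. Cossart, O. Piltant, J. Algebra 320 (2008) 1051–1082: proof of Prop. 9.3, (48)–(52)
  (HAL hal-00139124, p. 28). [CossartPiltant2008]
-/

namespace Literature.AlgebraicGeometry.Resolution

section StrictTransform

variable {S : Type*} [CommRing S] {ι : Type*} [Fintype ι]

/-- `(∏ xᵢ)^{C+1} = (∏ xᵢ^{cᵢ}) · (∏ xᵢ) · ∏ xᵢ^{C − cᵢ}` when `cᵢ ≤ C`; in particular
`(x₁⋯x_r)^{C+1} ∈ ((∏ xᵢ^{cᵢ}) ∏ xᵢ) S`. [cite: CossartPiltant2008, proof of Prop. 9.3, (50) (HAL p. 28)] -/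
theorem prod_pow_succ_eq (x : ι → S) (c : ι → ℕ) (C : ℕ) (hc : ∀ i, c i ≤ C) :
    (∏ i, x i) ^ (C + 1) = (∏ i, x i ^ c i) * (∏ i, x i) * ∏ i, x i ^ (C - c i) := by
  rw [← Finset.prod_pow, ← Finset.prod_mul_distrib, ← Finset.prod_mul_distrib]
  refine Finset.prod_congr rfl (fun i _ => ?_)
  rw [← pow_succ, ← pow_add]
  congr 1
  have := hc i
  omega

/-- **(48)+(50) ⟹ "`hⱼ = h′ⱼ ∏ xᵢ^{cᵢⱼ}` with `h′ⱼ ≡ g′ⱼ mod (x₁⋯x_r)`"**: the strict transform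
of an approximation modulo `(x₁⋯x_r)^{C+1}` of `g = g′ ∏ xᵢ^{cᵢ}` (`cᵢ ≤ C`).
[cite: CossartPiltant2008, proof of Prop. 9.3, (48)–(50) (HAL p. 28)] -/
theorem exists_strictTransform_of_sub_mem (x : ι → S) (c : ι → ℕ) (C : ℕ) (hc : ∀ i, c i ≤ C)
    (g g' h : S) (hg : g = g' * ∏ i, x i ^ c i)
    (hh : h - g ∈ Ideal.span {(∏ i, x i) ^ (C + 1)}) :
    ∃ h' : S, h = h' * ∏ i, x i ^ c i ∧ h' - g' ∈ Ideal.span {∏ i, x i} := by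
  obtain ⟨w, hw⟩ := Ideal.mem_span_singleton'.mp hh
  refine ⟨g' + w * (∏ i, x i) * ∏ i, x i ^ (C - c i), ?_, ?_⟩
  · have h1 : h = g + w * (∏ i, x i) ^ (C + 1) := by rw [hw]; ring
    rw [h1, hg, prod_pow_succ_eq x c C hc]
    ring
  · rw [add_sub_cancel_left]
    exact Ideal.mem_span_singleton'.mpr ⟨w * ∏ i, x i ^ (C - c i), by ring⟩

end StrictTransform

section Radical

variable {S : Type*} [CommRing S]

/-- **(46)+(47)+(51) ⟹ (52): the radical assembly.** Let `I` be an ideal containing, for every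
`i`, a unit multiple of `xᵢ^D`, and for every `j` a unit multiple of `h′ⱼ^D` where
`h′ⱼ ≡ g′ⱼ` modulo `(xᵢ)ᵢ`. Then the ideal generated by the `xᵢ` and the `g′ⱼ` is contained in
`√I`. (In [CoP1]: `Fᵢ = unit · xᵢ^{det A}` (46), `Hⱼ = unit · (h′ⱼ)^{det A}` with
`h′ⱼ ≡ g′ⱼ mod (x₁⋯x_r)` (51), and `(x₁, …, x_r, g′_{r+1}, …, g′₃) = m_{S′}` (47), whence
`√(({Fᵢ}, {Hⱼ}) S′) = m_{S′}` (52).)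
[cite: CossartPiltant2008, proof of Prop. 9.3, (52) (HAL p. 28)] -/
theorem span_le_radical_of_isUnit_mul_pow_mem {ι κ : Type*} (x : ι → S) (g' : κ → S)
    (I : Ideal S) (D : ℕ)
    (hx : ∀ i, ∃ u : S, IsUnit u ∧ u * x i ^ D ∈ I)
    (hg : ∀ j, ∃ u h' : S, IsUnit u ∧ u * h' ^ D ∈ I ∧ h' - g' j ∈ Ideal.span (Set.range x)) :
    Ideal.span (Set.range x ∪ Set.range g') ≤ I.radical := by
  have hxr : ∀ i, x i ∈ I.radical := by
    intro i
    obtain ⟨u, hu, huI⟩ := hx i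
    refine ⟨D, ?_⟩
    obtain ⟨v, hv⟩ := hu.exists_left_inv
    have : x i ^ D = v * (u * x i ^ D) := by rw [← mul_assoc, hv, one_mul]
    rw [this]
    exact Ideal.mul_mem_left _ _ huI
  have hspan : Ideal.span (Set.range x) ≤ I.radical :=
    Ideal.span_le.mpr (by rintro _ ⟨i, rfl⟩; exact hxr i)
  refine Ideal.span_le.mpr ?_
  rintro y (⟨i, rfl⟩ | ⟨j, rfl⟩)
  · exact hxr i
  · obtain ⟨u, h', hu, huI, hh'⟩ := hg j
    have hh'r : h' ∈ I.radical := by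
      refine ⟨D, ?_⟩
      obtain ⟨v, hv⟩ := hu.exists_left_inv
      have : h' ^ D = v * (u * h' ^ D) := by rw [← mul_assoc, hv, one_mul]
      rw [this]
      exact Ideal.mul_mem_left _ _ huI
    have : g' j = h' - (h' - g' j) := by ring
    rw [SetLike.mem_coe, this]
    exact Ideal.sub_mem _ hh'r (hspan hh')

/-- The equality form of (52): if moreover `I ≤ 𝔪` and `𝔪 = (xᵢ, g′ⱼ)` is prime, then
`√I = 𝔪`. [cite: CossartPiltant2008, proof of Prop. 9.3, (52) (HAL p. 28)] -/
theorem radical_eq_of_isUnit_mul_pow_mem {ι κ : Type*} (x : ι → S) (g' : κ → S)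
    (I 𝔪 : Ideal S) [𝔪.IsPrime] (h𝔪 : Ideal.span (Set.range x ∪ Set.range g') = 𝔪)
    (hI : I ≤ 𝔪) (D : ℕ)
    (hx : ∀ i, ∃ u : S, IsUnit u ∧ u * x i ^ D ∈ I)
    (hg : ∀ j, ∃ u h' : S, IsUnit u ∧ u * h' ^ D ∈ I ∧ h' - g' j ∈ Ideal.span (Set.range x)) :
    I.radical = 𝔪 :=
  le_antisymm ((Ideal.radical_le_radical_iff.mpr (hI.trans Ideal.le_radical)).trans
      (Ideal.IsPrime.radical ‹_›).le)
    (h𝔪 ▸ span_le_radical_of_isUnit_mul_pow_mem x g' I D hx hg)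

end Radical

end Literature.AlgebraicGeometry.Resolution
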